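import Summits.ValiantsHypothesis.ValiantsHypothesis.Theorems.GrenetZeonDualUnipotentThreeHalvesHeavyTopIotaFourGraded

/-!
# `GrenetZeon.DualUnipotentThreeHalves` (stmt-ValiantsHypothesis-24318), R2 `HeavyTopLaw` — towards ι(4) = 3 in the kernel:
# the generic-type-(4) case `typeFour_row_or_col` (experiment cell «val-heavytop-census», engine seat val-htc-eng-1)

Companion of `…HeavyTopIotaFourGraded` (graded-limit lemma `forms2`/`forms3`, small `4 × 4` facts); see its module docstring for
the programme (NOTE-iota4.md, lead replication PASS; split with port-3 g2 who types (T1) and the endings).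

**`typeFour_row_or_col`**: if `V ≤ M₄(ℂ)` has `A⁴ = 0` for all members, contains `J = E₀₁+E₁₂+E₂₃`, lies in
`T(J) = {B : B₃₀ = 0, B₂₀+B₃₁ = 0, B₁₀+B₂₁+B₃₂ = 0}`, and `dim V ≥ 4`, then in the same coordinates EITHER every member has zero
row `3` (invariant hyperplane `span{e₀,e₁,e₂}`) OR every member has zero column `0` (common kernel line `ℂe₀`).
Steps (NOTE-iota4 §2 reorganised without limits): `typeFour_ac` (forms `J`, `Y`: `(J+Y)⁴ = −ac·1`, so the height-`−1` part
`(a,b,c)` of a member with no height-`−2` entry has `ac = 0`); no height-`−2` entry anywhere ⇒ the shapes `c = 0` / `a = 0`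
cannot coexist ⇒ zero row `3` or zero column `0` (an eigenvalue of a nilpotent vanishes); a member `B₀` with `(B₀)₂₀ = 1` ⇒
`typeFour_F1/F2/F3/upper_eq_zero` (forms `E₂₀−E₃₁`, `J`, initial form of a strictly upper member) make an explicit linear map
`V → ℂ³` injective (trace orthogonality ✓ `Literature.LinearAlgebra.Matrix.trace_mul_eq_zero_of_mem` in one sub-case), so
`dim V ≤ 3` (`LinearMap.finrank_le_finrank_of_injective`), contradiction.

Honest framing: data for the instrument (with (T1) and the type-(3,1) file it yields «every nilpotent subspace of M₄(ℂ) of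
dimension ≥ 4 is reducible», i.e. ι(4) = 3); nothing here proves or refutes `HeavyTopLaw`, 24318, S3b or 8062; `VP ≠ VNP` is not
moved.  No definitions, no named facts. [NOTE-iota4 (this seat)]
-/

noncomputable section

-- single-conjunct layout: Sub = Summit, duplicated namespace component intended
set_option linter.dupNamespace false
set_option linter.unnecessarySeqFocus false

namespace Summit.ValiantsHypothesis.ValiantsHypothesis.Theorems.GrenetZeon.HeavyTopIotaFour

open Matrix Polynomial

/-! ## §3 Generic type `(4)`: the graded limit of a nilpotent `V ∋ J₄` of dimension `≥ 4` -/

section TypeFour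

variable (V : Submodule ℂ (Matrix (Fin 4) (Fin 4) ℂ))

/-- (2a) For `B ∈ V` with no height `-2` entry, the height `-1` part `(a,b,c)` (with `a+b+c = 0` from `T(J)`) has `ac = 0`:
the tridiagonal `J + Y` has `(J+Y)⁴ = -ac·1`. [NOTE-iota4 §2 (2a)] -/
theorem typeFour_ac (hV : ∀ A ∈ V, A ^ 4 = 0)
    (hJ : (!![0, 1, 0, 0; 0, 0, 1, 0; 0, 0, 0, 1; 0, 0, 0, 0] : Matrix (Fin 4) (Fin 4) ℂ) ∈ V)
    {B : Matrix (Fin 4) (Fin 4) ℂ} (hB : B ∈ V) (h30 : B 3 0 = 0) (h20 : B 2 0 = 0) (h31 : B 3 1 = 0)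
    (hsum : B 1 0 + B 2 1 + B 3 2 = 0) : B 1 0 * B 3 2 = 0 := by
  -- graded lemma with forms J (height 1) and Y (height -1)
  have key := forms2 (n := 4) (p := 4) (by norm_num) V hV
    (!![0, 1, 0, 0; 0, 0, 1, 0; 0, 0, 0, 1; 0, 0, 0, 0] : Matrix (Fin 4) (Fin 4) ℂ) B hJ hB 1 (-1)
    (by intro a b hab; fin_cases a <;> fin_cases b <;> simp at hab ⊢)
    (by intro a b hab; fin_cases a <;> fin_cases b <;> simp at hab ⊢ <;> assumption)
    1 1
  have hM : ((1 : ℂ) • Matrix.of (fun a b : Fin 4 => if (b : ℤ) - a = 1 then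
        (!![0, 1, 0, 0; 0, 0, 1, 0; 0, 0, 0, 1; 0, 0, 0, 0] : Matrix (Fin 4) (Fin 4) ℂ) a b else 0) +
      (1 : ℂ) • Matrix.of (fun a b : Fin 4 => if (b : ℤ) - a = -1 then B a b else 0)) =
      !![0, 1, 0, 0; B 1 0, 0, 1, 0; 0, B 2 1, 0, 1; 0, 0, B 3 2, 0] := by
    ext a b; fin_cases a <;> fin_cases b <;> simp
  rw [hM] at key
  have hsq : (!![0, 1, 0, 0; B 1 0, 0, 1, 0; 0, B 2 1, 0, 1; 0, 0, B 3 2, 0] : Matrix (Fin 4) (Fin 4) ℂ) *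
      !![0, 1, 0, 0; B 1 0, 0, 1, 0; 0, B 2 1, 0, 1; 0, 0, B 3 2, 0] =
      !![B 1 0, 0, 1, 0; 0, B 1 0 + B 2 1, 0, 1; B 1 0 * B 2 1, 0, B 2 1 + B 3 2, 0; 0, B 2 1 * B 3 2, 0, B 3 2] := by
    ext i j; fin_cases i <;> fin_cases j <;> simp [Matrix.mul_apply, Fin.sum_univ_four] <;> ring
  rw [pow_succ, pow_succ, pow_two, hsq, Matrix.mul_assoc, hsq] at key
  have e := congr_fun (congr_fun key 0) 0
  simp [Matrix.mul_apply, Fin.sum_univ_four] at e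
  have e' : B 1 0 * (B 1 0 + B 2 1) = 0 := by linear_combination e
  rcases mul_eq_zero.mp e' with e | e
  · rw [e, zero_mul]
  · have hc : B 3 2 = 0 := by linear_combination hsum - e
    rw [hc, mul_zero]

/-- The height `-2` initial form `E₂₀ - E₃₁` of a member `B₀` with `B₀ 2 0 = 1` kills the strictly upper part of `V`:
(F1) `N₂₃ = N₀₁` for every strictly upper `N ∈ V`. [NOTE-iota4 §2 (2b): tr M³ = 3b·n₂₃(n₁₂ − n₃₄)] -/
theorem typeFour_F1 (hV : ∀ A ∈ V, A ^ 4 = 0)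
    (hJ : (!![0, 1, 0, 0; 0, 0, 1, 0; 0, 0, 0, 1; 0, 0, 0, 0] : Matrix (Fin 4) (Fin 4) ℂ) ∈ V)
    {B₀ : Matrix (Fin 4) (Fin 4) ℂ} (hB₀ : B₀ ∈ V) (h30 : B₀ 3 0 = 0) (h20 : B₀ 2 0 = 1) (h31 : B₀ 3 1 = -1)
    {N : Matrix (Fin 4) (Fin 4) ℂ} (hN : N ∈ V) (hN10 : N 1 0 = 0) (hN20 : N 2 0 = 0) (hN30 : N 3 0 = 0)
    (hN21 : N 2 1 = 0) (hN31 : N 3 1 = 0) (hN32 : N 3 2 = 0) (hN00 : N 0 0 = 0) (hN11 : N 1 1 = 0)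
    (hN22 : N 2 2 = 0) (hN33 : N 3 3 = 0) : N 2 3 = N 0 1 := by
  -- forms: B₀ (height -2), J (height 1), N (height 1); coefficients (1, s, 1)
  have key : ∀ s : ℂ, ((s + N 0 1) * (s + N 1 2)) * (N 0 1 - N 2 3) = 0 := by
    intro s
    have k0 := forms3 (n := 4) (p := 4) (by norm_num) V hV
      B₀ (!![0, 1, 0, 0; 0, 0, 1, 0; 0, 0, 0, 1; 0, 0, 0, 0] : Matrix (Fin 4) (Fin 4) ℂ) N hB₀ hJ hN (-2) 1 1
      (by intro a b hab; fin_cases a <;> fin_cases b <;> simp at hab ⊢ <;> assumption)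
      (by intro a b hab; fin_cases a <;> fin_cases b <;> simp at hab ⊢)
      (by intro a b hab; fin_cases a <;> fin_cases b <;> simp at hab ⊢ <;> assumption)
      1 s 1
    have hM : ((1 : ℂ) • Matrix.of (fun a b : Fin 4 => if (b : ℤ) - a = -2 then B₀ a b else 0) +
        (s • Matrix.of (fun a b : Fin 4 => if (b : ℤ) - a = 1 then
          (!![0, 1, 0, 0; 0, 0, 1, 0; 0, 0, 0, 1; 0, 0, 0, 0] : Matrix (Fin 4) (Fin 4) ℂ) a b else 0) +
        (1 : ℂ) • Matrix.of (fun a b : Fin 4 => if (b : ℤ) - a = 1 then N a b else 0))) =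
        !![0, s + N 0 1, 0, 0; 0, 0, s + N 1 2, 0; 1, 0, 0, s + N 2 3; 0, -1, 0, 0] := by
      ext a b; fin_cases a <;> fin_cases b <;> simp [h20, h31]
    rw [hM] at k0
    have hsq : (!![0, s + N 0 1, 0, 0; 0, 0, s + N 1 2, 0; 1, 0, 0, s + N 2 3; 0, -1, 0, 0] : Matrix (Fin 4) (Fin 4) ℂ) *
        !![0, s + N 0 1, 0, 0; 0, 0, s + N 1 2, 0; 1, 0, 0, s + N 2 3; 0, -1, 0, 0] =
        !![0, 0, (s + N 0 1) * (s + N 1 2), 0; s + N 1 2, 0, 0, (s + N 1 2) * (s + N 2 3);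
           0, (s + N 0 1) - (s + N 2 3), 0, 0; 0, 0, -(s + N 1 2), 0] := by
      ext i j; fin_cases i <;> fin_cases j <;> simp [Matrix.mul_apply, Fin.sum_univ_four] <;> ring
    rw [pow_succ, pow_succ, pow_two, hsq, Matrix.mul_assoc, hsq] at k0
    have e := congr_fun (congr_fun k0 0) 1
    simp [Matrix.mul_apply, Fin.sum_univ_four] at e
    rcases e with (e | e) | e <;> simp [e]
  have k1 := key 0
  have k2 := key 1
  have k3 := key (-1)
  have h2 : (2 : ℂ) * (N 0 1 - N 2 3) = 0 := by linear_combination k2 + k3 - 2 * k1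
  have : N 0 1 - N 2 3 = 0 := by
    rcases mul_eq_zero.mp h2 with h | h
    · norm_num at h
    · exact h
  linear_combination -this

/-- (F2) With `B₀` as in (F1): a strictly upper `N ∈ V` with zero first superdiagonal has zero second superdiagonal. -/
theorem typeFour_F2 (hV : ∀ A ∈ V, A ^ 4 = 0)
    {B₀ : Matrix (Fin 4) (Fin 4) ℂ} (hB₀ : B₀ ∈ V) (h30 : B₀ 3 0 = 0) (h20 : B₀ 2 0 = 1) (h31 : B₀ 3 1 = -1)
    {N : Matrix (Fin 4) (Fin 4) ℂ} (hN : N ∈ V) (hN10 : N 1 0 = 0) (hN20 : N 2 0 = 0) (hN30 : N 3 0 = 0)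
    (hN21 : N 2 1 = 0) (hN31 : N 3 1 = 0) (hN32 : N 3 2 = 0) (hN00 : N 0 0 = 0) (hN11 : N 1 1 = 0)
    (hN22 : N 2 2 = 0) (hN33 : N 3 3 = 0) (hN01 : N 0 1 = 0) (hN12 : N 1 2 = 0) (hN23 : N 2 3 = 0) :
    N 0 2 = 0 ∧ N 1 3 = 0 := by
  have k0 := forms2 (n := 4) (p := 4) (by norm_num) V hV B₀ N hB₀ hN (-2) 2
    (by intro a b hab; fin_cases a <;> fin_cases b <;> simp at hab ⊢ <;> assumption)
    (by intro a b hab; fin_cases a <;> fin_cases b <;> simp at hab ⊢ <;> assumption)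
    1 1
  have hM : ((1 : ℂ) • Matrix.of (fun a b : Fin 4 => if (b : ℤ) - a = -2 then B₀ a b else 0) +
      (1 : ℂ) • Matrix.of (fun a b : Fin 4 => if (b : ℤ) - a = 2 then N a b else 0)) =
      !![0, 0, N 0 2, 0; 0, 0, 0, N 1 3; 1, 0, 0, 0; 0, -1, 0, 0] := by
    ext a b; fin_cases a <;> fin_cases b <;> simp [h20, h31]
  rw [hM] at k0
  have hsq : (!![0, 0, N 0 2, 0; 0, 0, 0, N 1 3; 1, 0, 0, 0; 0, -1, 0, 0] : Matrix (Fin 4) (Fin 4) ℂ) *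
      !![0, 0, N 0 2, 0; 0, 0, 0, N 1 3; 1, 0, 0, 0; 0, -1, 0, 0] =
      !![N 0 2, 0, 0, 0; 0, -(N 1 3), 0, 0; 0, 0, N 0 2, 0; 0, 0, 0, -(N 1 3)] := by
    ext i j; fin_cases i <;> fin_cases j <;> simp [Matrix.mul_apply, Fin.sum_univ_four]
  rw [pow_succ, pow_succ, pow_two, hsq, Matrix.mul_assoc, hsq] at k0
  have e0 := congr_fun (congr_fun k0 0) 0
  have e1 := congr_fun (congr_fun k0 1) 1
  simp [Matrix.mul_apply, Fin.sum_univ_four] at e0 e1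
  exact ⟨e0, e1⟩

/-- (F3) With `B₀` as in (F1): a strictly upper `N ∈ V` supported on the corner `(0,3)` vanishes. -/
theorem typeFour_F3 (hV : ∀ A ∈ V, A ^ 4 = 0)
    (hJ : (!![0, 1, 0, 0; 0, 0, 1, 0; 0, 0, 0, 1; 0, 0, 0, 0] : Matrix (Fin 4) (Fin 4) ℂ) ∈ V)
    {B₀ : Matrix (Fin 4) (Fin 4) ℂ} (hB₀ : B₀ ∈ V) (h30 : B₀ 3 0 = 0) (h20 : B₀ 2 0 = 1) (h31 : B₀ 3 1 = -1)
    {N : Matrix (Fin 4) (Fin 4) ℂ} (hN : N ∈ V) (hN10 : N 1 0 = 0) (hN20 : N 2 0 = 0) (hN30 : N 3 0 = 0)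
    (hN21 : N 2 1 = 0) (hN31 : N 3 1 = 0) (hN32 : N 3 2 = 0) (hN00 : N 0 0 = 0) (hN11 : N 1 1 = 0)
    (hN22 : N 2 2 = 0) (hN33 : N 3 3 = 0) (hN01 : N 0 1 = 0) (hN12 : N 1 2 = 0) (hN23 : N 2 3 = 0)
    (hN02 : N 0 2 = 0) (hN13 : N 1 3 = 0) : N 0 3 = 0 := by
  have k0 := forms3 (n := 4) (p := 4) (by norm_num) V hV
    B₀ (!![0, 1, 0, 0; 0, 0, 1, 0; 0, 0, 0, 1; 0, 0, 0, 0] : Matrix (Fin 4) (Fin 4) ℂ) N hB₀ hJ hN (-2) 1 3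
    (by intro a b hab; fin_cases a <;> fin_cases b <;> simp at hab ⊢ <;> assumption)
    (by intro a b hab; fin_cases a <;> fin_cases b <;> simp at hab ⊢)
    (by intro a b hab; fin_cases a <;> fin_cases b <;> simp at hab ⊢ <;> assumption)
    1 1 1
  have hM : ((1 : ℂ) • Matrix.of (fun a b : Fin 4 => if (b : ℤ) - a = -2 then B₀ a b else 0) +
      ((1 : ℂ) • Matrix.of (fun a b : Fin 4 => if (b : ℤ) - a = 1 then
        (!![0, 1, 0, 0; 0, 0, 1, 0; 0, 0, 0, 1; 0, 0, 0, 0] : Matrix (Fin 4) (Fin 4) ℂ) a b else 0) +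
      (1 : ℂ) • Matrix.of (fun a b : Fin 4 => if (b : ℤ) - a = 3 then N a b else 0))) =
      !![0, 1, 0, N 0 3; 0, 0, 1, 0; 1, 0, 0, 1; 0, -1, 0, 0] := by
    ext a b; fin_cases a <;> fin_cases b <;> simp [h20, h31]
  rw [hM] at k0
  have hsq : (!![0, 1, 0, N 0 3; 0, 0, 1, 0; 1, 0, 0, 1; 0, -1, 0, 0] : Matrix (Fin 4) (Fin 4) ℂ) *
      !![0, 1, 0, N 0 3; 0, 0, 1, 0; 1, 0, 0, 1; 0, -1, 0, 0] =
      !![0, -(N 0 3), 1, 0; 1, 0, 0, 1; 0, 0, 0, N 0 3; 0, 0, -1, 0] := by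
    ext i j; fin_cases i <;> fin_cases j <;> simp [Matrix.mul_apply, Fin.sum_univ_four]
  rw [pow_succ, pow_succ, pow_two, hsq, Matrix.mul_assoc, hsq] at k0
  have e := congr_fun (congr_fun k0 0) 0
  simp [Matrix.mul_apply, Fin.sum_univ_four] at e
  exact e

/-- (F4) With `B₀` as in (F1): a strictly upper `N ∈ V` with `N₀₁ = N₁₂ = 0` vanishes. -/
theorem typeFour_upper_eq_zero (hV : ∀ A ∈ V, A ^ 4 = 0)
    (hJ : (!![0, 1, 0, 0; 0, 0, 1, 0; 0, 0, 0, 1; 0, 0, 0, 0] : Matrix (Fin 4) (Fin 4) ℂ) ∈ V)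
    {B₀ : Matrix (Fin 4) (Fin 4) ℂ} (hB₀ : B₀ ∈ V) (h30 : B₀ 3 0 = 0) (h20 : B₀ 2 0 = 1) (h31 : B₀ 3 1 = -1)
    {N : Matrix (Fin 4) (Fin 4) ℂ} (hN : N ∈ V) (hN10 : N 1 0 = 0) (hN20 : N 2 0 = 0) (hN30 : N 3 0 = 0)
    (hN21 : N 2 1 = 0) (hN31 : N 3 1 = 0) (hN32 : N 3 2 = 0) (hN01 : N 0 1 = 0) (hN12 : N 1 2 = 0) : N = 0 := by
  obtain ⟨hN00, hN11, hN22, hN33⟩ := diag_zero_of_upper N hN10 hN20 hN30 hN21 hN31 hN32 (hV N hN)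
  have hN23 : N 2 3 = 0 := by
    rw [typeFour_F1 V hV hJ hB₀ h30 h20 h31 hN hN10 hN20 hN30 hN21 hN31 hN32 hN00 hN11 hN22 hN33, hN01]
  obtain ⟨hN02, hN13⟩ := typeFour_F2 V hV hB₀ h30 h20 h31 hN hN10 hN20 hN30 hN21 hN31 hN32 hN00 hN11 hN22 hN33
    hN01 hN12 hN23
  have hN03 := typeFour_F3 V hV hJ hB₀ h30 h20 h31 hN hN10 hN20 hN30 hN21 hN31 hN32 hN00 hN11 hN22 hN33
    hN01 hN12 hN23 hN02 hN13
  ext i j; fin_cases i <;> fin_cases j <;> simp <;> assumption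

/-- **Type (4), the core of ι(4) = 3** (NOTE-iota4 §2): if `V ≤ M₄(ℂ)` is a linear space of matrices with `A⁴ = 0` for all
`A ∈ V`, containing `J = E₀₁+E₁₂+E₂₃`, lying in `T(J)` (the three lower diagonal-sum conditions), and `dim V ≥ 4`, then in the SAME
coordinates either every member has zero last row (invariant hyperplane `span{e₀,e₁,e₂}`) or every member has zero first column
(common kernel line `ℂe₀`). [NOTE-iota4 §2; this file] -/
theorem typeFour_row_or_col (hV : ∀ A ∈ V, A ^ 4 = 0)
    (hJ : (!![0, 1, 0, 0; 0, 0, 1, 0; 0, 0, 0, 1; 0, 0, 0, 0] : Matrix (Fin 4) (Fin 4) ℂ) ∈ V)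
    (hT : ∀ B ∈ V, B 3 0 = 0 ∧ B 2 0 + B 3 1 = 0 ∧ B 1 0 + B 2 1 + B 3 2 = 0)
    (hdim : 4 ≤ Module.finrank ℂ V) :
    (∀ B ∈ V, ∀ j : Fin 4, B 3 j = 0) ∨ (∀ B ∈ V, ∀ i : Fin 4, B i 0 = 0) := by
  classical
  have hnil : ∀ A ∈ V, IsNilpotent A := fun A hA => ⟨4, hV A hA⟩
  by_cases hR2 : ∀ B ∈ V, B 2 0 = 0
  · -- no height -2 part anywhere: the lower part of every member is its height -1 part (a, b, c), with ac = 0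
    have hac : ∀ B ∈ V, B 1 0 * B 3 2 = 0 := fun B hB =>
      typeFour_ac V hV hJ hB (hT B hB).1 (hR2 B hB) (by have := (hT B hB).2.1; rw [hR2 B hB] at this; simpa using this)
        (hT B hB).2.2
    by_cases hA : ∀ B ∈ V, B 1 0 = 0
    · -- zero first column
      right
      intro B hB i
      have h0 : B 0 0 = 0 := by
        have e := pow4_00 B (hA B hB) (hR2 B hB) (hT B hB).1
        rw [hV B hB] at e
        exact (pow_eq_zero_iff (n := 4) (by norm_num)).mp (by simpa using e.symm)
      fin_cases i
      · exact h0
      · exact hA B hB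
      · exact hR2 B hB
      · exact (hT B hB).1
    · by_cases hB' : ∀ B ∈ V, B 1 0 + B 2 1 = 0
      · -- zero last row
        left
        intro B hB j
        have h31 : B 3 1 = 0 := by have := (hT B hB).2.1; rw [hR2 B hB] at this; simpa using this
        have h32 : B 3 2 = 0 := by have := (hT B hB).2.2; linear_combination this - hB' B hB
        have h33 : B 3 3 = 0 := by
          have e := pow4_33 B (hT B hB).1 h31 h32
          rw [hV B hB] at e
          exact (pow_eq_zero_iff (n := 4) (by norm_num)).mp (by simpa using e.symm)
        fin_cases j
        · exact (hT B hB).1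
        · exact h31
        · exact h32
        · exact h33
      · -- both shapes present: their sum violates ac = 0
        exfalso
        push Not at hA hB'
        obtain ⟨B₁, hB₁, h1⟩ := hA
        obtain ⟨B₂, hB₂, h2⟩ := hB'
        have s1 := (hT B₁ hB₁).2.2
        have s2 := (hT B₂ hB₂).2.2
        have a1 := hac B₁ hB₁
        have a2 := hac B₂ hB₂
        have c1 : B₁ 3 2 = 0 := by
          rcases mul_eq_zero.mp a1 with h | h
          · exact absurd h h1
          · exact h
        have c2 : B₂ 3 2 ≠ 0 := by
          intro h; apply h2; linear_combination s2 - h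
        have d2 : B₂ 1 0 = 0 := by
          rcases mul_eq_zero.mp a2 with h | h
          · exact h
          · exact absurd h c2
        have a3 := hac (B₁ + B₂) (V.add_mem hB₁ hB₂)
        simp only [Matrix.add_apply, c1, d2, add_zero, zero_add] at a3
        rcases mul_eq_zero.mp a3 with h | h
        · exact h1 h
        · exact c2 h
  · -- a member with a height -2 entry: then dim V ≤ 3, contradiction
    exfalso
    push Not at hR2
    obtain ⟨B, hB, hB20⟩ := hR2
    set B₀ : Matrix (Fin 4) (Fin 4) ℂ := (B 2 0)⁻¹ • B with hB₀def
    have hB₀ : B₀ ∈ V := V.smul_mem _ hB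
    have h20 : B₀ 2 0 = 1 := by simp [hB₀def, inv_mul_cancel₀ hB20]
    have h30 : B₀ 3 0 = 0 := (hT B₀ hB₀).1
    have h31 : B₀ 3 1 = -1 := by have := (hT B₀ hB₀).2.1; rw [h20] at this; linear_combination this
    -- common facts for members without height -2 part
    have hac : ∀ X ∈ V, X 2 0 = 0 → X 1 0 * X 3 2 = 0 := fun X hX hX20 =>
      typeFour_ac V hV hJ hX (hT X hX).1 hX20 (by have := (hT X hX).2.1; rw [hX20] at this; simpa using this)
        (hT X hX).2.2
    -- the finrank bound from an injective map to ℂ³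
    have hbound : ∀ (Ψ : Matrix (Fin 4) (Fin 4) ℂ →ₗ[ℂ] (Fin 3 → ℂ)), (∀ X ∈ V, Ψ X = 0 → X = 0) → False := by
      intro Ψ hΨ
      have hinj : Function.Injective (Ψ.domRestrict V) := by
        intro x y hxy
        apply Subtype.ext
        have h0 : Ψ (x.1 - y.1) = 0 := by
          rw [map_sub]; exact sub_eq_zero.mpr (by simpa using hxy)
        have := hΨ (x.1 - y.1) (V.sub_mem x.2 y.2) h0
        exact sub_eq_zero.mp this
      have hle := LinearMap.finrank_le_finrank_of_injective hinj
      simp only [Module.finrank_fin_fun] at hle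
      omega
    by_cases hP : ∃ B₁ ∈ V, B₁ 2 0 = 0 ∧ (B₁ 1 0 ≠ 0 ∨ B₁ 2 1 ≠ 0)
    · obtain ⟨B₁, hB₁, hB₁20, hB₁nz⟩ := hP
      have hB₁21 : B₁ 2 1 ≠ 0 := by
        rcases hB₁nz with h | h
        · intro h21
          have a1 := hac B₁ hB₁ hB₁20
          rcases mul_eq_zero.mp a1 with h' | h'
          · exact h h'
          · apply h; have := (hT B₁ hB₁).2.2; rw [h21, h'] at this; simpa using this
        · exact h
      refine hbound
        { toFun := fun X => ![X 2 0, X 1 0 - X 2 1, X 0 1]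
          map_add' := by intro X Y; ext i; fin_cases i <;> simp <;> ring
          map_smul' := by intro c X; ext i; fin_cases i <;> simp <;> ring } ?_
      intro X hX hΨ
      have e0 := congr_fun hΨ 0
      have e1 := congr_fun hΨ 1
      have e2 := congr_fun hΨ 2
      simp at e0 e1 e2
      -- e0 : X 2 0 = 0, e1 : X 1 0 - X 2 1 = 0 (or X 1 0 = X 2 1), e2 : X 0 1 = 0
      have hX20 : X 2 0 = 0 := e0
      have hX31 : X 3 1 = 0 := by have := (hT X hX).2.1; rw [hX20] at this; simpa using this
      have hX30 : X 3 0 = 0 := (hT X hX).1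
      have hsum := (hT X hX).2.2
      have hX10 : X 1 0 = 0 := by
        have a := hac X hX hX20
        have h21 : X 2 1 = X 1 0 := by linear_combination -e1
        have h32 : X 3 2 = -2 * X 1 0 := by linear_combination hsum - h21
        rw [h32] at a
        have : X 1 0 ^ 2 = 0 := by linear_combination -(1/2 : ℂ) * a
        exact pow_eq_zero_iff (n := 2) (by norm_num) |>.mp this
      have hX21 : X 2 1 = 0 := by linear_combination -e1 + hX10
      have hX32 : X 3 2 = 0 := by linear_combination hsum - hX10 - hX21
      obtain ⟨hX00, hX11, hX22, hX33⟩ := diag_zero_of_upper X hX10 hX20 hX30 hX21 hX31 hX32 (hV X hX)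
      have hX01 : X 0 1 = 0 := e2
      have hX23 : X 2 3 = 0 := by
        rw [typeFour_F1 V hV hJ hB₀ h30 h20 h31 hX hX10 hX20 hX30 hX21 hX31 hX32 hX00 hX11 hX22 hX33, hX01]
      -- trace orthogonality with B₁ gives X 1 2 = 0
      have htr := Literature.LinearAlgebra.Matrix.trace_mul_eq_zero_of_mem V hnil hB₁ hX
      have hB₁31 : B₁ 3 1 = 0 := by have := (hT B₁ hB₁).2.1; rw [hB₁20] at this; simpa using this
      have hB₁30 : B₁ 3 0 = 0 := (hT B₁ hB₁).1
      simp [Matrix.trace, Matrix.mul_apply, Fin.sum_univ_four, hX10, hX20, hX30, hX21, hX31, hX32, hX00, hX11,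
        hX22, hX33, hX01, hX23, hB₁20, hB₁31, hB₁30] at htr
      have hX12 : X 1 2 = 0 := by
        rcases htr with h | h
        · exact absurd h hB₁21
        · exact h
      exact typeFour_upper_eq_zero V hV hJ hB₀ h30 h20 h31 hX hX10 hX20 hX30 hX21 hX31 hX32 hX01 hX12
    · push Not at hP
      refine hbound
        { toFun := fun X => ![X 2 0, X 0 1, X 1 2]
          map_add' := by intro X Y; ext i; fin_cases i <;> simp
          map_smul' := by intro c X; ext i; fin_cases i <;> simp } ?_
      intro X hX hΨ
      have e0 := congr_fun hΨ 0
      have e1 := congr_fun hΨ 1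
      have e2 := congr_fun hΨ 2
      simp at e0 e1 e2
      have hX20 : X 2 0 = 0 := e0
      obtain ⟨hX10, hX21⟩ := hP X hX hX20
      have hX31 : X 3 1 = 0 := by have := (hT X hX).2.1; rw [hX20] at this; simpa using this
      have hX30 : X 3 0 = 0 := (hT X hX).1
      have hX32 : X 3 2 = 0 := by have := (hT X hX).2.2; rw [hX10, hX21] at this; simpa using this
      exact typeFour_upper_eq_zero V hV hJ hB₀ h30 h20 h31 hX hX10 hX20 hX30 hX21 hX31 hX32 e1 e2

end TypeFour

end Summit.ValiantsHypothesis.ValiantsHypothesis.Theorems.GrenetZeon.HeavyTopIotaFour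

end
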